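import Mathlib.Tactic.LinearCombination
import Summits.MatrixMultiplication.OmegaCensus.DihedralLawModOneShapeBLemmas
import Summits.MatrixMultiplication.OmegaCensus.NearPeriodicHalfSet
import HarnessLib

/-!
# Alignment of the 2-parts in a cube law shape: the character identity and the cyclic-direction cases

ω-census, family (b3).  Framing: lottery ticket; floor = certified bounds/negative ranges.

Lemma Q of `FAMILY-B-ADDENDUM-g4.md` §7 (pub-omega, group seat gen 4): for `M, P ⊆ A` (`|A| = 6m+1`, `|M| = 2m`,
`|P| = m`) and `t, t′` with the two vertex near-tilings of a cube TPP triple whose `T`-parts are `{·,·+t}`, `{·,·+t′}`,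
 (i)  `𝟙_M(y) + 𝟙_M(y−t) + 𝟙_P(y) + 𝟙_P(y−t′) = [y ≠ x₀]`,
 (ii′) `𝟙_M(y) + 𝟙_M(y−t′) + 𝟙_P(y−t′) + 𝟙_P(y−t′+t) = [y ≠ x₀′]`,
one has `t′ = ±t`.  This file proves the two Fourier steps of the blueprint:

* `charsum_M_eq_mul_charsum_P` (Step 3): if moreover `x₀′ = x₀ + h` with `h + h = t′ − t` (the hole relation,
  supplied by `NearPeriodicHalfSet.lean`), then for every character `ψ` with `ψ(t′−t) ≠ 1` and `ψ(t+t′) ≠ 1`: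
  `M̂(ψ) = ψ(h)·P̂(ψ)` — i.e. `M` and `P + h` have the same Fourier transform off `⟨t′−t⟩^⊥ ∪ ⟨t+t′⟩^⊥`.
* `periodic_diff_of_charsum_eq` (Step 4, Fourier inversion): if `M̂(ψ) = ψ(h) P̂(ψ)` for all `ψ` with `ψ(w) ≠ 1`,
  then `𝟙_M − 𝟙_{P+h}` is `w`-periodic, hence (`addOrderOf_dvd_card_sub_card`) `ord(w) ∣ |M| − |P|`.
* `aligned_of_generator` (Step 4 (a)/(b)): consequently, if `t + t′` generates `A` then `ord(t′−t) ∣ |M| − |P|`,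
  and if `t′ − t` generates `A` then `ord(t+t′) ∣ |M| − |P|`; with `|M| − |P| = m` coprime to `|A| = 6m+1` this
  forces `t′ = t` (resp. `t′ = −t`).  The remaining case (neither generates) needs the coset counting of §7 (c).
-/

namespace Summit.MatrixMultiplication.OmegaCensus

open Finset

section Alignment

variable {A : Type*} [AddCommGroup A] [Fintype A] [DecidableEq A]

/-- Character sum of a shifted indicator: `∑_y [y - s ∈ X] ψ y = ψ s · X̂(ψ)`. [folklore] -/
theorem sum_indicator_sub_mem (ψ : AddChar A ℂ) (X : Finset A) (s : A) :
    ∑ y : A, (if y - s ∈ X then ψ y else 0) = ψ s * ∑ x ∈ X, ψ x := by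
  rw [mul_sum]
  rw [← sum_filter]
  have hset : (univ.filter fun y : A => y - s ∈ X) = X.image (· + s) := by
    ext y; simp only [mem_filter, mem_univ, true_and, mem_image]
    constructor
    · intro h; exact ⟨y - s, h, sub_add_cancel y s⟩
    · rintro ⟨x, hx, rfl⟩; simpa using hx
  rw [hset, sum_image fun a _ b _ h => add_right_cancel h]
  exact sum_congr rfl fun x _ => by rw [AddChar.map_add_eq_mul, mul_comm]

/-- Character sum of an indicator: `∑_y [y ∈ X] ψ y = X̂(ψ)`. [folklore] -/
theorem sum_indicator_mem (ψ : AddChar A ℂ) (X : Finset A) :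
    ∑ y : A, (if y ∈ X then ψ y else 0) = ∑ x ∈ X, ψ x := by
  rw [← sum_filter]; congr 1; ext y; simp

/-- **Step 3 (character identity).** Under the indicator forms of (i), (ii′) and the hole relation
`x₀′ = x₀ + h`, `h + h = t′ − t`: `M̂(ψ) = ψ(h) P̂(ψ)` whenever `ψ(t′ − t) ≠ 1` and `ψ(t + t′) ≠ 1`. [folklore] -/
theorem charsum_M_eq_mul_charsum_P {M P : Finset A} {t t' x₀ h : A}
    (hi : ∀ y : A, ((if y ∈ M then (1 : ℤ) else 0) + (if y - t ∈ M then 1 else 0) + (if y ∈ P then 1 else 0) +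
      (if y - t' ∈ P then 1 else 0)) = if y = x₀ then 0 else 1)
    (hii : ∀ y : A, ((if y ∈ M then (1 : ℤ) else 0) + (if y - t' ∈ M then 1 else 0) + (if y - t' ∈ P then 1 else 0) +
      (if y - (t' - t) ∈ P then 1 else 0)) = if y = x₀ + h then 0 else 1)
    (hh : h + h = t' - t) (ψ : AddChar A ℂ) (hu : ψ (t' - t) ≠ 1) (hv : ψ (t + t') ≠ 1) :
    ∑ x ∈ M, ψ x = ψ h * ∑ x ∈ P, ψ x := by
  have hψ : ψ ≠ 0 := by rintro rfl; exact hu (by simp)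
  -- the two tilings as character identities
  have tot : ∑ y : A, ψ y = 0 := AddChar.sum_eq_zero_iff_ne_zero.2 hψ
  have cast_sum : ∀ (f : A → ℤ) (x : A), (∀ y, f y = if y = x then 0 else 1) →
      ∑ y : A, (f y : ℂ) * ψ y = -ψ x := by
    intro f x hf
    have : ∑ y : A, (f y : ℂ) * ψ y = ∑ y : A, (ψ y - if y = x then ψ y else 0) := by
      refine sum_congr rfl fun y _ => ?_
      rw [hf y]; split_ifs <;> simp
    rw [this, sum_sub_distrib, tot, sum_ite_eq' univ x, if_pos (mem_univ x), zero_sub]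
  have E1 := cast_sum _ x₀ hi
  have E2 := cast_sum _ (x₀ + h) hii
  simp only [Int.cast_add, Int.cast_ite, Int.cast_one, Int.cast_zero, add_mul, ite_mul, one_mul, zero_mul,
    sum_add_distrib, sum_indicator_mem, sum_indicator_sub_mem] at E1 E2
  -- abbreviations and relations
  set m := ∑ x ∈ M, ψ x with hm
  set p := ∑ x ∈ P, ψ x with hp
  have et' : ψ t' = ψ t * (ψ h * ψ h) := by
    rw [← AddChar.map_add_eq_mul, ← AddChar.map_add_eq_mul, hh]; congr 1; abel
  have eu : ψ (t' - t) = ψ h * ψ h := by rw [← hh, AddChar.map_add_eq_mul]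
  have ex : ψ (x₀ + h) = ψ x₀ * ψ h := AddChar.map_add_eq_mul ψ x₀ h
  have htt : ψ t * ψ (-t) = 1 := addChar_mul_neg ψ t
  have ett : ψ (t' - t) = ψ t' * ψ (-t) := by rw [sub_eq_add_neg, AddChar.map_add_eq_mul]
  rw [et', ex] at E2
  rw [ett, et'] at E2
  rw [et'] at E1
  -- `ζ := ψ h ≠ 1` and `ψ t · ψ h ≠ 1`
  have hζ : ψ h ≠ 1 := by
    intro h1; apply hu; rw [eu, h1, mul_one]
  have hαζ : ψ t * ψ h ≠ 1 := by
    intro h1; apply hv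
    have : ψ (t + t') = (ψ t * ψ h) * (ψ t * ψ h) := by
      rw [AddChar.map_add_eq_mul, et']; ring
    rw [this, h1, mul_one]
  -- `(ζ E1 − E2) = (ζ − 1)(1 − αζ)(m − ζ p)`
  have key : (ψ h - 1) * (1 - ψ t * ψ h) * (m - ψ h * p) = 0 := by
    linear_combination (ψ h) * E1 - E2 + ((ψ h) ^ 2 * p) * htt
  have h1 : (ψ h - 1) * (1 - ψ t * ψ h) ≠ 0 := mul_ne_zero (sub_ne_zero.2 hζ) (sub_ne_zero.2 (Ne.symm hαζ))
  have := (mul_eq_zero.1 key).resolve_left h1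
  exact sub_eq_zero.1 this

/-- **Fourier inversion.** If `M̂(ψ) = ψ(h)·P̂(ψ)` for every `ψ` with `ψ(w) ≠ 1`, then `𝟙_M − 𝟙_{P+h}` is
`w`-periodic. [folklore] -/
theorem periodic_diff_of_charsum_eq {M P : Finset A} {h w : A}
    (hMP : ∀ ψ : AddChar A ℂ, ψ w ≠ 1 → ∑ x ∈ M, ψ x = ψ h * ∑ x ∈ P, ψ x) (y : A) :
    ((if y ∈ M then (1 : ℤ) else 0) - (if y - h ∈ P then 1 else 0)) =
      ((if y + w ∈ M then (1 : ℤ) else 0) - (if y + w - h ∈ P then 1 else 0)) := by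
  -- `∑_ψ D̂(ψ) ψ(−z) = N · D(z)`
  have key : ∀ z : A, (∑ ψ : AddChar A ℂ, ((∑ x ∈ M, ψ x) - ψ h * ∑ x ∈ P, ψ x) * ψ (-z)) =
      (Fintype.card A : ℂ) * ((if z ∈ M then (1 : ℂ) else 0) - (if z - h ∈ P then (1 : ℂ) else 0)) := by
    intro z
    have e1 : ∀ ψ : AddChar A ℂ, ((∑ x ∈ M, ψ x) - ψ h * ∑ x ∈ P, ψ x) * ψ (-z) =
        (∑ x ∈ M, ψ (x + -z)) - ∑ x ∈ P, ψ (x + (h + -z)) := by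
      intro ψ
      rw [sub_mul, sum_mul, mul_comm (ψ h), mul_assoc, sum_mul]
      congr 1
      · exact sum_congr rfl fun x _ => (AddChar.map_add_eq_mul ψ x (-z)).symm
      · exact sum_congr rfl fun x _ => by
          rw [AddChar.map_add_eq_mul, AddChar.map_add_eq_mul]
    simp_rw [e1]
    rw [sum_sub_distrib, sum_comm]
    conv_lhs => arg 2; rw [sum_comm]
    simp_rw [AddChar.sum_apply_eq_ite]
    have f1 : ∀ x : A, (x + -z = 0) = (x = z) := fun x => by
      rw [add_neg_eq_zero]
    have f2 : ∀ x : A, (x + (h + -z) = 0) = (x = z - h) := fun x => by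
      apply propext; constructor <;> intro hx
      · have := add_neg_eq_zero.1 (show (x + h) + -z = 0 by rw [add_assoc]; exact hx); rw [← this]; abel
      · rw [hx]; abel
    simp_rw [f1, f2]
    rw [sum_ite_eq' M z, sum_ite_eq' P (z - h)]
    split_ifs <;> ring
  -- the terms with `ψ w ≠ 1` vanish, the others are `w`-periodic
  have hz : ∀ z : A, (∑ ψ : AddChar A ℂ, ((∑ x ∈ M, ψ x) - ψ h * ∑ x ∈ P, ψ x) * ψ (-z)) =
      ∑ ψ : AddChar A ℂ, ((∑ x ∈ M, ψ x) - ψ h * ∑ x ∈ P, ψ x) * ψ (-(z + w)) := by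
    intro z
    refine sum_congr rfl fun ψ _ => ?_
    by_cases hψ : ψ w = 1
    · have : ψ (-(z + w)) = ψ (-z) := by
        rw [neg_add, AddChar.map_add_eq_mul]
        have hw : ψ (-w) = 1 := by
          have := addChar_mul_neg ψ w; rw [hψ, one_mul] at this; exact this
        rw [hw, mul_one]
      rw [this]
    · rw [hMP ψ hψ, sub_self, zero_mul, zero_mul]
  have h1 := key y
  have h2 := key (y + w)
  rw [hz y, h2] at h1
  have hN : (Fintype.card A : ℂ) ≠ 0 := Nat.cast_ne_zero.2 Fintype.card_ne_zero
  have h3 := mul_left_cancel₀ hN h1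
  rw [add_sub_right_comm] at h3
  have h4 : (((if y ∈ M then (1 : ℤ) else 0) - (if y - h ∈ P then 1 else 0) : ℤ) : ℂ) =
      (((if y + w ∈ M then (1 : ℤ) else 0) - (if y - h + w ∈ P then 1 else 0) : ℤ) : ℂ) := by
    push_cast; exact h3.symm
  have h5 := (Int.cast_inj (α := ℂ)).1 h4
  rw [add_sub_right_comm]
  exact h5

/-- A `w`-periodic difference of two indicators: `ord(w)` divides `|M| − |P|`. [folklore] -/
theorem addOrderOf_dvd_card_sub_card {M P' : Finset A} {w : A}
    (hper : ∀ y : A, ((if y ∈ M then (1 : ℤ) else 0) - (if y ∈ P' then 1 else 0)) =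
      ((if y + w ∈ M then (1 : ℤ) else 0) - (if y + w ∈ P' then 1 else 0))) :
    (addOrderOf w : ℤ) ∣ (M.card : ℤ) - P'.card := by
  have h1 : ∀ y ∈ M \ P', y + w ∈ M \ P' := by
    intro y hy
    rw [mem_sdiff] at hy ⊢
    have h := hper y
    rw [if_pos hy.1, if_neg hy.2] at h
    constructor
    · by_contra hc; rw [if_neg hc] at h; split_ifs at h <;> omega
    · intro hc; rw [if_pos hc] at h; split_ifs at h <;> omega
  have h2 : ∀ y ∈ P' \ M, y + w ∈ P' \ M := by
    intro y hy
    rw [mem_sdiff] at hy ⊢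
    have h := hper y
    rw [if_neg hy.2, if_pos hy.1] at h
    constructor
    · by_contra hc; rw [if_neg hc] at h; split_ifs at h <;> omega
    · intro hc; rw [if_pos hc] at h; split_ifs at h <;> omega
  have d1 := addOrderOf_dvd_card_of_forall_add_mem h1
  have d2 := addOrderOf_dvd_card_of_forall_add_mem h2
  have e : (M.card : ℤ) - P'.card = ((M \ P').card : ℤ) - ((P' \ M).card : ℤ) := by
    have a1 := card_sdiff_add_card_inter M P'
    have a2 := card_sdiff_add_card_inter P' M
    rw [inter_comm] at a2
    push_cast [← a1, ← a2]
    ring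
  rw [e]
  exact dvd_sub (Int.natCast_dvd_natCast.2 d1) (Int.natCast_dvd_natCast.2 d2)


omit [DecidableEq A] in
/-- If `g` generates `A`, a non-trivial character does not vanish... takes a value `≠ 1` at `g`. [folklore] -/
theorem addChar_apply_ne_one_of_zmultiples_eq_top {g : A} (hg : AddSubgroup.zmultiples g = ⊤) {ψ : AddChar A ℂ}
    (hψ : ψ ≠ 0) : ψ g ≠ 1 := by
  classical
  intro h1
  apply hψ
  ext a
  have ha : a ∈ AddSubgroup.zmultiples g := by rw [hg]; exact AddSubgroup.mem_top a
  obtain ⟨n, -, rfl⟩ := mem_image.1 ((mem_zmultiples_iff_mem_range_addOrderOf).1 ha)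
  rw [AddChar.map_nsmul_eq_pow, h1, one_pow, AddChar.zero_apply]

/-- **Alignment, cases (a)/(b) of Lemma Q.** Indicator forms of the two near-tilings (i), (ii′) with
`|M| = 2|P|`, `|A| = 2|M| + 2|P| + 1`; if `t + t′` or `t′ − t` generates `A`, then `t′ = ±t`. [folklore] -/
theorem aligned_of_generator {M P : Finset A} {t t' x₀ x₀' : A}
    (hi : ∀ y : A, ((if y ∈ M then (1 : ℤ) else 0) + (if y - t ∈ M then 1 else 0) + (if y ∈ P then 1 else 0) +
      (if y - t' ∈ P then 1 else 0)) = if y = x₀ then 0 else 1)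
    (hii : ∀ y : A, ((if y ∈ M then (1 : ℤ) else 0) + (if y - t' ∈ M then 1 else 0) + (if y - t' ∈ P then 1 else 0) +
      (if y - (t' - t) ∈ P then 1 else 0)) = if y = x₀' then 0 else 1)
    (hMP : M.card = 2 * P.card) (hN : Fintype.card A = 2 * M.card + 2 * P.card + 1)
    (hgen : AddSubgroup.zmultiples (t + t') = ⊤ ∨ AddSubgroup.zmultiples (t' - t) = ⊤) :
    t' = t ∨ t' = -t := by
  by_cases hu : t' - t = 0
  · exact Or.inl (sub_eq_zero.1 hu)
  by_cases hv : t + t' = 0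
  · exact Or.inr (eq_neg_of_add_eq_zero_right hv)
  exfalso
  -- the set `W = (M + t) ⊔ P` and its near-periodicity in direction `u = t' - t`
  have hW : ∀ y : A, ((if y ∈ M.image (· + t) ∪ P then (1 : ℤ) else 0) -
      (if y - (t' - t) ∈ M.image (· + t) ∪ P then 1 else 0)) =
      (if y = x₀' then (1 : ℤ) else 0) - (if y = x₀ then 1 else 0) := by
    intro y
    have h1 := hi y
    have h2 := hii y
    have e1 : (if y ∈ M.image (· + t) ∪ P then (1 : ℤ) else 0) =
        (if y - t ∈ M then (1 : ℤ) else 0) + (if y ∈ P then 1 else 0) := by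
      have hmem : (y ∈ M.image (· + t) ∪ P) ↔ (y - t ∈ M ∨ y ∈ P) := by rw [mem_union, mem_image_add]
      by_cases ha : y - t ∈ M
      · by_cases hb : y ∈ P
        · exfalso; rw [if_pos ha, if_pos hb] at h1; split_ifs at h1 <;> omega
        · rw [if_pos (hmem.2 (Or.inl ha)), if_pos ha, if_neg hb]; norm_num
      · by_cases hb : y ∈ P
        · rw [if_pos (hmem.2 (Or.inr hb)), if_neg ha, if_pos hb]; norm_num
        · rw [if_neg (fun h => (hmem.1 h).elim ha hb), if_neg ha, if_neg hb]; norm_num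
    have e2 : (if y - (t' - t) ∈ M.image (· + t) ∪ P then (1 : ℤ) else 0) =
        (if y - t' ∈ M then (1 : ℤ) else 0) + (if y - (t' - t) ∈ P then 1 else 0) := by
      have hmem : (y - (t' - t) ∈ M.image (· + t) ∪ P) ↔ (y - t' ∈ M ∨ y - (t' - t) ∈ P) := by
        rw [mem_union, mem_image_add, show y - (t' - t) - t = y - t' by abel]
      by_cases ha : y - t' ∈ M
      · by_cases hb : y - (t' - t) ∈ P
        · exfalso; rw [if_pos ha, if_pos hb] at h2; split_ifs at h2 <;> omega
        · rw [if_pos (hmem.2 (Or.inl ha)), if_pos ha, if_neg hb]; norm_num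
      · by_cases hb : y - (t' - t) ∈ P
        · rw [if_pos (hmem.2 (Or.inr hb)), if_neg ha, if_pos hb]; norm_num
        · rw [if_neg (fun h => (hmem.1 h).elim ha hb), if_neg ha, if_neg hb]; norm_num
    rw [e1, e2]
    split_ifs at h1 h2 ⊢ <;> omega
  have hdisj : Disjoint (M.image (· + t)) P := by
    rw [disjoint_left]
    intro y hy hyP
    have h1 := hi y
    rw [mem_image_add] at hy
    rw [if_pos hy, if_pos hyP] at h1; split_ifs at h1 <;> omega
  have cW : 2 * (M.image (· + t) ∪ P).card + 1 = Fintype.card A := by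
    rw [card_union_of_disjoint hdisj, card_image_add, hN]; ring
  have hhole := two_mul_eq_of_near_periodic_half_set hu hW cW
  set h := x₀' - x₀ with hh
  have hx₀' : x₀' = x₀ + h := by rw [hh]; abel
  have hii' : ∀ y : A, ((if y ∈ M then (1 : ℤ) else 0) + (if y - t' ∈ M then 1 else 0) +
      (if y - t' ∈ P then 1 else 0) + (if y - (t' - t) ∈ P then 1 else 0)) = if y = x₀ + h then 0 else 1 := by
    intro y; rw [← hx₀']; exact hii y
  have hchar := fun (ψ : AddChar A ℂ) => charsum_M_eq_mul_charsum_P hi hii' hhole ψ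
  -- `m = |M| - |P + h| = |P|`
  have hm : (M.card : ℤ) - (P.image (· + h)).card = P.card := by rw [card_image_add, hMP]; push_cast; ring
  have hN' : Fintype.card A = 6 * P.card + 1 := by rw [hN, hMP]; ring
  rcases hgen with hgv | hgu
  · -- `v` generates: `D` is `u`-periodic, `ord u ∣ |P|`, `ord u ∣ 6|P|+1`
    have hper : ∀ y : A, ((if y ∈ M then (1 : ℤ) else 0) - (if y ∈ P.image (· + h) then 1 else 0)) =
        ((if y + (t' - t) ∈ M then (1 : ℤ) else 0) - (if y + (t' - t) ∈ P.image (· + h) then 1 else 0)) := by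
      intro y
      simp only [mem_image_add]
      refine periodic_diff_of_charsum_eq (fun ψ hψu => hchar ψ hψu ?_) y
      exact addChar_apply_ne_one_of_zmultiples_eq_top hgv (by rintro rfl; exact hψu (by simp))
    have hd := addOrderOf_dvd_card_sub_card hper
    rw [hm] at hd
    have hd' : addOrderOf (t' - t) ∣ P.card := Int.natCast_dvd_natCast.1 hd
    have hdN : addOrderOf (t' - t) ∣ Fintype.card A := addOrderOf_dvd_card
    rw [hN'] at hdN
    have h1 : addOrderOf (t' - t) ∣ 1 :=
      (Nat.dvd_add_right (dvd_mul_of_dvd_right hd' 6)).1 hdN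
    have : addOrderOf (t' - t) = 1 := Nat.dvd_one.1 h1
    exact hu (AddMonoid.addOrderOf_eq_one_iff.1 this)
  · -- `u` generates: `D` is `v`-periodic
    have hper : ∀ y : A, ((if y ∈ M then (1 : ℤ) else 0) - (if y ∈ P.image (· + h) then 1 else 0)) =
        ((if y + (t + t') ∈ M then (1 : ℤ) else 0) - (if y + (t + t') ∈ P.image (· + h) then 1 else 0)) := by
      intro y
      simp only [mem_image_add]
      refine periodic_diff_of_charsum_eq (fun ψ hψv => hchar ψ ?_ hψv) y
      exact addChar_apply_ne_one_of_zmultiples_eq_top hgu (by rintro rfl; exact hψv (by simp))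
    have hd := addOrderOf_dvd_card_sub_card hper
    rw [hm] at hd
    have hd' : addOrderOf (t + t') ∣ P.card := Int.natCast_dvd_natCast.1 hd
    have hdN : addOrderOf (t + t') ∣ Fintype.card A := addOrderOf_dvd_card
    rw [hN'] at hdN
    have h1 : addOrderOf (t + t') ∣ 1 :=
      (Nat.dvd_add_right (dvd_mul_of_dvd_right hd' 6)).1 hdN
    have : addOrderOf (t + t') = 1 := Nat.dvd_one.1 h1
    exact hv (AddMonoid.addOrderOf_eq_one_iff.1 this)

end Alignment

end Summit.MatrixMultiplication.OmegaCensus
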